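import Summits.BirchSwinnertonDyer.BirchSwinnertonDyer.Theorems.RamifiedHeegnerPairStepLIntrinsic
import HarnessLib

/-!
# STEP L (adjusted, tower-row shape) at the intrinsic rank-one classes — part D: `355338h1`, `409248cy1`, `439794p1`, `205128l1`

Continuation of `RamifiedHeegnerPairStepLIntrinsic` (door `existsAdjustedStepLAt_of_sqrtField`, conventions, data provenance and the
"what this is NOT" list are in that file's header): per class `E`, the kernel instance `stepL_at_<label>` of the `∃`-body of
`Sig.stub_existsAdjustedStepL_towerRows` (= `hEx` of §5 `RamifiedPairLowerBound.gssLowerAtThree_rankOne_towerRows_of_exists_adjustedIndexBound`,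
the load-bearing stub of line `kolyvagin_split` of crux 26021) over `K = ℚ(√D)`, and `row_<label>` (`Addv ∧ SubGss ∧ ρ_{E,3}` onto). All four reuse the k1 records' `Wd` (`D = -71, -335, -95, -887`) and `SubGss`/surjectivity theorems by name.
Seat `bsd-trib-w-rhp` g9; helper `--supports` 23191; data kit j304302 / j304074 / j304038. **BSD is not proved; nothing is booked;
26021 / 23191 / `L₁` stay OPEN.**
[cite: JetchevSkinnerWan2017, §7.4.1 (pp. 29–31)] [cite: GrossZagier1986, Thm. I.(6.3), V.§2] [cite: Darmon2004, Thm. 3.6]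
[cite: Cremona2006, Table 1] [cite: SilvermanAEC2009, VII.1, VII.5]
-/

set_option autoImplicit false

noncomputable section

open scoped Classical NumberField

open WeierstrassCurve NumberField IsDedekindDomain IsDedekindDomain.HeightOneSpectrum Rat.HeightOneSpectrum Field
  Literature.NumberTheory.DiophantineGeometry Literature.NumberTheory.EllipticCurves
  Literature.NumberTheory.EllipticCurves.ModularForms Literature.NumberTheory.EllipticCurves.Rank1Residual
  Literature.NumberTheory.EllipticCurves.Rank1Residual.Typed Literature.NumberTheory.Automorphic
  Literature.NumberTheory.EllipticCurves.Rank1Residual.X11RankOneCertificates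
  Literature.NumberTheory.GaloisRepresentations Literature.NumberTheory.QuadraticFields
  Summit.BirchSwinnertonDyer.BirchSwinnertonDyer.Rank1Residual.IntModel
  Summit.BirchSwinnertonDyer.Rank1Residual Summit.BirchSwinnertonDyer.Rank1Residual.Additive
  Summit.BirchSwinnertonDyer.Rank1Residual.X11b Summit.BirchSwinnertonDyer.Rank1Residual.GaloisImage
  Summit.BirchSwinnertonDyer.Rank1Residual.Supersingular
  Summit.BirchSwinnertonDyer.BirchSwinnertonDyer.Theses.AdditiveKolyvaginRoad
  Summit.BirchSwinnertonDyer.BirchSwinnertonDyer.Theorems.AdditiveKolyvaginKernel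
  Summit.BirchSwinnertonDyer.BirchSwinnertonDyer.Theorems
  Summit.BirchSwinnertonDyer.BirchSwinnertonDyer.Theorems.AdditiveBranchIMCGordTwoRankOne.HeegnerKolyvagin

namespace Summit.BirchSwinnertonDyer.BirchSwinnertonDyer.Theorems.RamifiedHeegnerPairStepLIntrinsic


/-! ## `355338h1` = `[1, -1, 0, 22278, 8543762]`, `N = 355338 = 2·3^2·19·1039`, `K = ℚ(√-71)`, `Wd = [1, -1, 0, 112302453, -3059927850925]` (`N(Wd) = 1791258858`), kit j304074 -/

/-- **Row membership of `355338h1`, kernel part**: additive (G) ∧ ss at `3` and `ρ_{E,3}` onto (`n = 1` of the tower). The levels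
`n ≥ 2`: `ρ_{E,9}` is onto — Frobenius witnesses `(a_ℓ, ℓ) mod 9 = (3, 4)` at `ℓ = 13` (outside the profile of the 27 index-27 subgroups) and `(0, 5)` at `ℓ = 5` (outside the index-3 subgroup's), these being ALL maximal mod-3-surjective proper subgroups of `GL₂(ℤ/9)`
(exact enumeration, Lines card `stepl_intrinsic.md` of item 23191) — whence `ρ_{E,3^n}` onto for all `n` by Serre's lifting lemma; not typed here.
[cite: Serre1972, IV-23 Lemma 3 with its Exercise 3 (p = 3: surjectivity mod 9 suffices)] [cite: Cremona2006, Table 1 (Cremona label 355338h1)] -/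
theorem row_355338h1 :
    haveI := isElliptic_g355338h1; haveI := isGloballyMinimal_g355338h1
    Addv (⟨1, -1, 0, 22278, 8543762⟩ : WeierstrassCurve ℚ) 3 ∧ SubGss (⟨1, -1, 0, 22278, 8543762⟩ : WeierstrassCurve ℚ) 3 ∧ (⟨1, -1, 0, 22278, 8543762⟩ : WeierstrassCurve ℚ).HasSurjectiveModNGaloisRep (3 ^ 1 : ℕ) := by
  have h : (⟨1, -1, 0, 22278, 8543762⟩ : WeierstrassCurve ℚ).HasSurjectiveModNGaloisRep ((3 : ℕ) : ℤ) := surj_g355338h1_3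
  exact ⟨subGss_g355338h1_3.1, subGss_g355338h1_3.2, by simpa using h⟩

/-- **STEP L (adjusted, tower-row shape) AT `355338h1` over `K = ℚ(√-71)`** — an instance of the `∃`-body of
`Sig.stub_existsAdjustedStepL_towerRows` (= `hEx` of §5) at an INTRINSIC class (`#Ш(E)_an = 9`). KERNEL: `K = sqrtField (-71)` (imaginary
quadratic, `d_K = -71`), the Heegner hypothesis at `N = 355338` (`-71 ≡ 1 (mod 8)`, `(-71/ℓ) = 1` at the odd `ℓ ∣ N`), the Heegner datum `β = 95941`
(`4N ∣ β² − (-71)`), minimality of `Wd = [1, -1, 0, 112302453, -3059927850925]` (`k1 record, by name`), the twist identity `Cd • E^{(-71)} = Wd`,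
`[u,r,s,t] = [1, -18, 1/2, 0]` (`3`-unit), `3 ∤ #𝓞_K^×`; `P ∈ E(K)` over the complex Heegner point is Darmon Thm 3.6 (tree theorem
`heegnerPointComplex_mem_range_map_holds`). PUBLISHED binders: `hmodP` (BCDT), `hGZ`, `hKo`, `hGZK`, `hmod`. DISPLAYED numerics: Cremona's
`N(E) = 355338` (`hN`), `r_an(E) = 1` (`hr`), `#Ш(E)_an = q`, `ord₃ q ≤ 2` (`hq`/`hv`), the rigorous 3-descent certificate `27 ∣ #Sel₃(E)` (`hSel`,
L1Intrinsic records), `L(E^{(-71)},1) = 0.1697421715 ≠ 0` (`hLt`; PARI `ellL1` = `lfun`, agree True), `#Ш(Wd)_an = 1` (`hqd`/`hvd`;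
`N(Wd) = 1791258858`, `∏c(Wd) = 8`, `#Wd(ℚ)_tors = 1`). INSTRUMENT (not used in the proof): Gross–Zagier heights give `[E(K):ℤy_K]² /4 = ρ = ĥ(y_K)/ĥ(P_gen) = 144.0`, `m = 24` (`ord₃ m = 1`; float error 0.0e+00); BSD-budget prediction `ord₃ m = (ord₃#Ш(E)_an + ord₃#Ш(Wd)_an + ord₃∏c(E) + ord₃∏c(Wd))/2 = (2+0+0+0)/2 = 1`.
Nothing is booked; L₁ / items 26021, 23191 stay OPEN; BSD is not proved by this.
[cite: JetchevSkinnerWan2017, §7.4.1 (pp. 29–31)] [cite: GrossZagier1986, Thm. I.(6.3), V.§2] [cite: Darmon2004, Thm. 3.6]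
[cite: SchaeferStoll2004, Cor. 5.9] [cite: Marcus2018, Ch. 3 Thm. 25] [cite: Cremona2006, Table 1 (Cremona label 355338h1)] -/
theorem stepL_at_355338h1
    (hmodP : nonempty_modularParametrizationData)
    (hGZ : ∀ (N : ℕ) [NeZero N] (W : WeierstrassCurve ℚ) (K : Type) [Field K] [NumberField K], gross_zagier N W K)
    (hKo : ∀ (N : ℕ) [NeZero N] (W : WeierstrassCurve ℚ) (K : Type) [Field K] [NumberField K], kolyvagin N W K)
    (hGZK : rank_eq_analyticRank_of_analyticRank_le_one) (hmod : hasEntireLFunction_rat)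
    {W : WeierstrassCurve ℚ} [W.IsElliptic] [W.IsGloballyMinimal] (hWeq : W = (⟨1, -1, 0, 22278, 8543762⟩ : WeierstrassCurve ℚ))
    (hN : W.conductorNorm ℤ = 355338) (hr : W.analyticRank = 1)
    {q : ℚ} (hq : shaAn W = (q : ℂ)) (hv : padicValRat 3 q ≤ 2) (hSel : 3 ^ 3 ∣ Nat.card (W.selmerGroup 3))
    (hLt : (W.quadraticTwist ((-71 : ℤ) : ℚ)).entireLFunction 1 ≠ 0)
    {qd : ℚ} (hqd : haveI := isElliptic_gWd355338h1; shaAn (⟨1, -1, 0, 112302453, -3059927850925⟩ : WeierstrassCurve ℚ) = (qd : ℂ)) (hvd : padicValRat 3 qd ≤ 0) :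
    ∃ (N : ℕ) (_ : NeZero N) (K : Type) (_ : Field K) (_ : NumberField K)
      (Dt : ModularParametrizationData W N) (H : HeegnerDatum N (NumberField.discr K)) (ι : K →+* ℂ)
      (P : (W.baseChange K).toAffine.Point)
      (Wd : WeierstrassCurve ℚ) (_ : Wd.IsElliptic) (_ : Wd.IsGloballyMinimal) (Cd : VariableChange ℚ),
      W.conductorNorm ℤ = N ∧ IsImaginaryQuadratic K ∧ SatisfiesHeegnerHypothesis N K ∧
      (W.quadraticTwist (NumberField.discr K : ℚ)).entireLFunction 1 ≠ 0 ∧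
      WeierstrassCurve.Affine.Point.map ι.toRatAlgHom P = heegnerPointComplex Dt H ∧
      Cd • W.quadraticTwist (NumberField.discr K : ℚ) = Wd ∧
      (Finite (W.baseChange K).sha →
        (2 * padicValNat 3 (AddSubgroup.zmultiples P).index : ℤ) ≤
          padicValNat 3 (W.baseChange K).shaOrder + padicValNat 3 W.tamagawaProduct +
            padicValNat 3 Wd.tamagawaProduct + 2 * padicValRat 3 (Dt.c : ℚ)) := by
  subst hWeq
  haveI := isElliptic_gWd355338h1; haveI := isGloballyMinimal_gWd355338h1
  haveI : Fact ((-71 : ℤ) < 0) := ⟨by norm_num⟩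
  haveI : NeZero (355338 : ℕ) := ⟨by norm_num⟩
  have hlow : MissingLowerBoundAt (⟨1, -1, 0, 22278, 8543762⟩ : WeierstrassCurve ℚ) 3 :=
    RamifiedHeegnerPairL1Intrinsic.lowerHalf_three_355338h1 hGZK hr hq hv hSel
  have hjac : ∀ ℓ : ℕ, ℓ.Prime → ℓ ∣ 355338 → ℓ ≠ 2 → jacobiSym (-71) ℓ = 1 := by
    intro ℓ hℓ hℓN hℓ2
    have hmem : ℓ ∈ Nat.primeFactors 355338 := Nat.mem_primeFactors.mpr ⟨hℓ, hℓN, by norm_num⟩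
    have hpf : Nat.primeFactors 355338 = {2, 3, 19, 1039} := by decide +kernel
    rw [hpf] at hmem
    simp only [Finset.mem_insert, Finset.mem_singleton] at hmem
    rcases hmem with rfl | rfl | rfl | rfl
    · exact absurd rfl hℓ2
    all_goals norm_num
  have hWd : (⟨1, ((-18 : ℚ)), ((1 : ℚ)/2), (0 : ℚ)⟩ : VariableChange ℚ) •
      (⟨1, -1, 0, 22278, 8543762⟩ : WeierstrassCurve ℚ).quadraticTwist ((-71 : ℤ) : ℚ) = (⟨1, -1, 0, 112302453, -3059927850925⟩ : WeierstrassCurve ℚ) := by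
    push_cast
    ext <;> simp [WeierstrassCurve.variableChange_a₁, WeierstrassCurve.variableChange_a₂,
      WeierstrassCurve.variableChange_a₃, WeierstrassCurve.variableChange_a₄, WeierstrassCurve.variableChange_a₆,
      WeierstrassCurve.quadraticTwist, WeierstrassCurve.b₂, WeierstrassCurve.b₄, WeierstrassCurve.b₆] <;> norm_num
  exact existsAdjustedStepLAt_of_sqrtField _ 355338 (-71) (by norm_num)
    (by rw [show (-71 : ℤ).natAbs = 71 by rfl, Nat.squarefree_iff_nodup_primeFactorsList (by norm_num)]; simp)
    hjac 95941 (by norm_num) (by norm_num) hmodP hN hGZ hKo hGZK hmod hr hLt hlow _ _ hWd (by simp) hqd hvd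

/-! ## `409248cy1` = `[0, 0, 0, -626472, 190853712]`, `N = 409248 = 2^5·3^2·7^2·29`, `K = ℚ(√-335)`, `Wd = [0, 0, 0, -70305820200, -7175216872782000]` (`N(Wd) = 45927856800`), kit j304074 -/

/-- **Row membership of `409248cy1`, kernel part**: additive (G) ∧ ss at `3` and `ρ_{E,3}` onto (`n = 1` of the tower). The levels
`n ≥ 2`: `ρ_{E,9}` is onto — Frobenius witnesses `(a_ℓ, ℓ) mod 9 = (1, 4)` at `ℓ = 13` (outside the profile of the 27 index-27 subgroups) and `(1, 5)` at `ℓ = 5` (outside the index-3 subgroup's), these being ALL maximal mod-3-surjective proper subgroups of `GL₂(ℤ/9)`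
(exact enumeration, Lines card `stepl_intrinsic.md` of item 23191) — whence `ρ_{E,3^n}` onto for all `n` by Serre's lifting lemma; not typed here.
[cite: Serre1972, IV-23 Lemma 3 with its Exercise 3 (p = 3: surjectivity mod 9 suffices)] [cite: Cremona2006, Table 1 (Cremona label 409248cy1)] -/
theorem row_409248cy1 :
    haveI := isElliptic_g409248cy1; haveI := isGloballyMinimal_g409248cy1
    Addv (⟨0, 0, 0, -626472, 190853712⟩ : WeierstrassCurve ℚ) 3 ∧ SubGss (⟨0, 0, 0, -626472, 190853712⟩ : WeierstrassCurve ℚ) 3 ∧ (⟨0, 0, 0, -626472, 190853712⟩ : WeierstrassCurve ℚ).HasSurjectiveModNGaloisRep (3 ^ 1 : ℕ) := by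
  have h : (⟨0, 0, 0, -626472, 190853712⟩ : WeierstrassCurve ℚ).HasSurjectiveModNGaloisRep ((3 : ℕ) : ℤ) := surj_g409248cy1_3
  exact ⟨subGss_g409248cy1_3.1, subGss_g409248cy1_3.2, by simpa using h⟩

/-- **STEP L (adjusted, tower-row shape) AT `409248cy1` over `K = ℚ(√-335)`** — an instance of the `∃`-body of
`Sig.stub_existsAdjustedStepL_towerRows` (= `hEx` of §5) at an INTRINSIC class (`#Ш(E)_an = 9`). KERNEL: `K = sqrtField (-335)` (imaginary
quadratic, `d_K = -335`), the Heegner hypothesis at `N = 409248` (`-335 ≡ 1 (mod 8)`, `(-335/ℓ) = 1` at the odd `ℓ ∣ N`), the Heegner datum `β = 20551`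
(`4N ∣ β² − (-335)`), minimality of `Wd = [0, 0, 0, -70305820200, -7175216872782000]` (`k1 record, by name`), the twist identity `Cd • E^{(-335)} = Wd`,
`[u,r,s,t] = [1, 0, 0, 0]` (`3`-unit), `3 ∤ #𝓞_K^×`; `P ∈ E(K)` over the complex Heegner point is Darmon Thm 3.6 (tree theorem
`heegnerPointComplex_mem_range_map_holds`). PUBLISHED binders: `hmodP` (BCDT), `hGZ`, `hKo`, `hGZK`, `hmod`. DISPLAYED numerics: Cremona's
`N(E) = 409248` (`hN`), `r_an(E) = 1` (`hr`), `#Ш(E)_an = q`, `ord₃ q ≤ 2` (`hq`/`hv`), the rigorous 3-descent certificate `27 ∣ #Sel₃(E)` (`hSel`,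
L1Intrinsic records), `L(E^{(-335)},1) = 0.5933783668 ≠ 0` (`hLt`; PARI `ellL1` = `lfun`, agree True), `#Ш(Wd)_an = 4` (`hqd`/`hvd`;
`N(Wd) = 45927856800`, `∏c(Wd) = 16`, `#Wd(ℚ)_tors = 1`). INSTRUMENT (not used in the proof): Gross–Zagier heights give `[E(K):ℤy_K]² /4 = ρ = ĥ(y_K)/ĥ(P_gen) = 2304.0`, `m = 96` (`ord₃ m = 1`; float error 1.4e-14); BSD-budget prediction `ord₃ m = (ord₃#Ш(E)_an + ord₃#Ш(Wd)_an + ord₃∏c(E) + ord₃∏c(Wd))/2 = (2+0+0+0)/2 = 1`.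
Nothing is booked; L₁ / items 26021, 23191 stay OPEN; BSD is not proved by this.
[cite: JetchevSkinnerWan2017, §7.4.1 (pp. 29–31)] [cite: GrossZagier1986, Thm. I.(6.3), V.§2] [cite: Darmon2004, Thm. 3.6]
[cite: SchaeferStoll2004, Cor. 5.9] [cite: Marcus2018, Ch. 3 Thm. 25] [cite: Cremona2006, Table 1 (Cremona label 409248cy1)] -/
theorem stepL_at_409248cy1
    (hmodP : nonempty_modularParametrizationData)
    (hGZ : ∀ (N : ℕ) [NeZero N] (W : WeierstrassCurve ℚ) (K : Type) [Field K] [NumberField K], gross_zagier N W K)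
    (hKo : ∀ (N : ℕ) [NeZero N] (W : WeierstrassCurve ℚ) (K : Type) [Field K] [NumberField K], kolyvagin N W K)
    (hGZK : rank_eq_analyticRank_of_analyticRank_le_one) (hmod : hasEntireLFunction_rat)
    {W : WeierstrassCurve ℚ} [W.IsElliptic] [W.IsGloballyMinimal] (hWeq : W = (⟨0, 0, 0, -626472, 190853712⟩ : WeierstrassCurve ℚ))
    (hN : W.conductorNorm ℤ = 409248) (hr : W.analyticRank = 1)
    {q : ℚ} (hq : shaAn W = (q : ℂ)) (hv : padicValRat 3 q ≤ 2) (hSel : 3 ^ 3 ∣ Nat.card (W.selmerGroup 3))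
    (hLt : (W.quadraticTwist ((-335 : ℤ) : ℚ)).entireLFunction 1 ≠ 0)
    {qd : ℚ} (hqd : haveI := isElliptic_gWd409248cy1; shaAn (⟨0, 0, 0, -70305820200, -7175216872782000⟩ : WeierstrassCurve ℚ) = (qd : ℂ)) (hvd : padicValRat 3 qd ≤ 0) :
    ∃ (N : ℕ) (_ : NeZero N) (K : Type) (_ : Field K) (_ : NumberField K)
      (Dt : ModularParametrizationData W N) (H : HeegnerDatum N (NumberField.discr K)) (ι : K →+* ℂ)
      (P : (W.baseChange K).toAffine.Point)
      (Wd : WeierstrassCurve ℚ) (_ : Wd.IsElliptic) (_ : Wd.IsGloballyMinimal) (Cd : VariableChange ℚ),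
      W.conductorNorm ℤ = N ∧ IsImaginaryQuadratic K ∧ SatisfiesHeegnerHypothesis N K ∧
      (W.quadraticTwist (NumberField.discr K : ℚ)).entireLFunction 1 ≠ 0 ∧
      WeierstrassCurve.Affine.Point.map ι.toRatAlgHom P = heegnerPointComplex Dt H ∧
      Cd • W.quadraticTwist (NumberField.discr K : ℚ) = Wd ∧
      (Finite (W.baseChange K).sha →
        (2 * padicValNat 3 (AddSubgroup.zmultiples P).index : ℤ) ≤
          padicValNat 3 (W.baseChange K).shaOrder + padicValNat 3 W.tamagawaProduct +
            padicValNat 3 Wd.tamagawaProduct + 2 * padicValRat 3 (Dt.c : ℚ)) := by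
  subst hWeq
  haveI := isElliptic_gWd409248cy1; haveI := isGloballyMinimal_gWd409248cy1
  haveI : Fact ((-335 : ℤ) < 0) := ⟨by norm_num⟩
  haveI : NeZero (409248 : ℕ) := ⟨by norm_num⟩
  have hlow : MissingLowerBoundAt (⟨0, 0, 0, -626472, 190853712⟩ : WeierstrassCurve ℚ) 3 :=
    RamifiedHeegnerPairL1Intrinsic.lowerHalf_three_409248cy1 hGZK hr hq hv hSel
  have hjac : ∀ ℓ : ℕ, ℓ.Prime → ℓ ∣ 409248 → ℓ ≠ 2 → jacobiSym (-335) ℓ = 1 := by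
    intro ℓ hℓ hℓN hℓ2
    have hmem : ℓ ∈ Nat.primeFactors 409248 := Nat.mem_primeFactors.mpr ⟨hℓ, hℓN, by norm_num⟩
    have hpf : Nat.primeFactors 409248 = {2, 3, 7, 29} := by decide +kernel
    rw [hpf] at hmem
    simp only [Finset.mem_insert, Finset.mem_singleton] at hmem
    rcases hmem with rfl | rfl | rfl | rfl
    · exact absurd rfl hℓ2
    all_goals norm_num
  have hWd : (⟨1, (0 : ℚ), (0 : ℚ), (0 : ℚ)⟩ : VariableChange ℚ) •
      (⟨0, 0, 0, -626472, 190853712⟩ : WeierstrassCurve ℚ).quadraticTwist ((-335 : ℤ) : ℚ) = (⟨0, 0, 0, -70305820200, -7175216872782000⟩ : WeierstrassCurve ℚ) := by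
    push_cast
    ext <;> simp [WeierstrassCurve.variableChange_a₁, WeierstrassCurve.variableChange_a₂,
      WeierstrassCurve.variableChange_a₃, WeierstrassCurve.variableChange_a₄, WeierstrassCurve.variableChange_a₆,
      WeierstrassCurve.quadraticTwist, WeierstrassCurve.b₂, WeierstrassCurve.b₄, WeierstrassCurve.b₆] <;> norm_num
  exact existsAdjustedStepLAt_of_sqrtField _ 409248 (-335) (by norm_num)
    (by rw [show (-335 : ℤ).natAbs = 335 by rfl, Nat.squarefree_iff_nodup_primeFactorsList (by norm_num)]; simp)
    hjac 20551 (by norm_num) (by norm_num) hmodP hN hGZ hKo hGZK hmod hr hLt hlow _ _ hWd (by simp) hqd hvd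

/-! ## `439794p1` = `[1, -1, 0, -412053, -101704843]`, `N = 439794 = 2·3^2·53·461`, `K = ℚ(√-95)`, `Wd = [1, -1, 0, -3718780017, 87288440474141]` (`N(Wd) = 3969140850`), kit j304074 -/

/-- **Row membership of `439794p1`, kernel part**: additive (G) ∧ ss at `3` and `ρ_{E,3}` onto (`n = 1` of the tower). The levels
`n ≥ 2`: `ρ_{E,9}` is onto — Frobenius witness `(a_ℓ, ℓ) mod 9 = (3, 5)` at `ℓ = 5`, outside the `(tr, det)`-profile of the 27 index-27 subgroups AND of the index-3 subgroup, these being ALL maximal mod-3-surjective proper subgroups of `GL₂(ℤ/9)`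
(exact enumeration, Lines card `stepl_intrinsic.md` of item 23191) — whence `ρ_{E,3^n}` onto for all `n` by Serre's lifting lemma; not typed here.
[cite: Serre1972, IV-23 Lemma 3 with its Exercise 3 (p = 3: surjectivity mod 9 suffices)] [cite: Cremona2006, Table 1 (Cremona label 439794p1)] -/
theorem row_439794p1 :
    haveI := isElliptic_g439794p1; haveI := isGloballyMinimal_g439794p1
    Addv (⟨1, -1, 0, -412053, -101704843⟩ : WeierstrassCurve ℚ) 3 ∧ SubGss (⟨1, -1, 0, -412053, -101704843⟩ : WeierstrassCurve ℚ) 3 ∧ (⟨1, -1, 0, -412053, -101704843⟩ : WeierstrassCurve ℚ).HasSurjectiveModNGaloisRep (3 ^ 1 : ℕ) := by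
  have h : (⟨1, -1, 0, -412053, -101704843⟩ : WeierstrassCurve ℚ).HasSurjectiveModNGaloisRep ((3 : ℕ) : ℤ) := surj_g439794p1_3
  exact ⟨subGss_g439794p1_3.1, subGss_g439794p1_3.2, by simpa using h⟩

/-- **STEP L (adjusted, tower-row shape) AT `439794p1` over `K = ℚ(√-95)`** — an instance of the `∃`-body of
`Sig.stub_existsAdjustedStepL_towerRows` (= `hEx` of §5) at an INTRINSIC class (`#Ш(E)_an = 9`). KERNEL: `K = sqrtField (-95)` (imaginary
quadratic, `d_K = -95`), the Heegner hypothesis at `N = 439794` (`-95 ≡ 1 (mod 8)`, `(-95/ℓ) = 1` at the odd `ℓ ∣ N`), the Heegner datum `β = 52319`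
(`4N ∣ β² − (-95)`), minimality of `Wd = [1, -1, 0, -3718780017, 87288440474141]` (`k1 record, by name`), the twist identity `Cd • E^{(-95)} = Wd`,
`[u,r,s,t] = [1, -24, 1/2, 0]` (`3`-unit), `3 ∤ #𝓞_K^×`; `P ∈ E(K)` over the complex Heegner point is Darmon Thm 3.6 (tree theorem
`heegnerPointComplex_mem_range_map_holds`). PUBLISHED binders: `hmodP` (BCDT), `hGZ`, `hKo`, `hGZK`, `hmod`. DISPLAYED numerics: Cremona's
`N(E) = 439794` (`hN`), `r_an(E) = 1` (`hr`), `#Ш(E)_an = q`, `ord₃ q ≤ 2` (`hq`/`hv`), the rigorous 3-descent certificate `27 ∣ #Sel₃(E)` (`hSel`,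
L1Intrinsic records), `L(E^{(-95)},1) = 1.8275222549 ≠ 0` (`hLt`; PARI `ellL1` = `lfun`, agree True), `#Ш(Wd)_an = 4` (`hqd`/`hvd`;
`N(Wd) = 3969140850`, `∏c(Wd) = 8`, `#Wd(ℚ)_tors = 1`). INSTRUMENT (not used in the proof): Gross–Zagier heights give `[E(K):ℤy_K]² /4 = ρ = ĥ(y_K)/ĥ(P_gen) = 576.0`, `m = 48` (`ord₃ m = 1`; float error 0.0e+00); BSD-budget prediction `ord₃ m = (ord₃#Ш(E)_an + ord₃#Ш(Wd)_an + ord₃∏c(E) + ord₃∏c(Wd))/2 = (2+0+0+0)/2 = 1`.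
Nothing is booked; L₁ / items 26021, 23191 stay OPEN; BSD is not proved by this.
[cite: JetchevSkinnerWan2017, §7.4.1 (pp. 29–31)] [cite: GrossZagier1986, Thm. I.(6.3), V.§2] [cite: Darmon2004, Thm. 3.6]
[cite: SchaeferStoll2004, Cor. 5.9] [cite: Marcus2018, Ch. 3 Thm. 25] [cite: Cremona2006, Table 1 (Cremona label 439794p1)] -/
theorem stepL_at_439794p1
    (hmodP : nonempty_modularParametrizationData)
    (hGZ : ∀ (N : ℕ) [NeZero N] (W : WeierstrassCurve ℚ) (K : Type) [Field K] [NumberField K], gross_zagier N W K)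
    (hKo : ∀ (N : ℕ) [NeZero N] (W : WeierstrassCurve ℚ) (K : Type) [Field K] [NumberField K], kolyvagin N W K)
    (hGZK : rank_eq_analyticRank_of_analyticRank_le_one) (hmod : hasEntireLFunction_rat)
    {W : WeierstrassCurve ℚ} [W.IsElliptic] [W.IsGloballyMinimal] (hWeq : W = (⟨1, -1, 0, -412053, -101704843⟩ : WeierstrassCurve ℚ))
    (hN : W.conductorNorm ℤ = 439794) (hr : W.analyticRank = 1)
    {q : ℚ} (hq : shaAn W = (q : ℂ)) (hv : padicValRat 3 q ≤ 2) (hSel : 3 ^ 3 ∣ Nat.card (W.selmerGroup 3))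
    (hLt : (W.quadraticTwist ((-95 : ℤ) : ℚ)).entireLFunction 1 ≠ 0)
    {qd : ℚ} (hqd : haveI := isElliptic_gWd439794p1; shaAn (⟨1, -1, 0, -3718780017, 87288440474141⟩ : WeierstrassCurve ℚ) = (qd : ℂ)) (hvd : padicValRat 3 qd ≤ 0) :
    ∃ (N : ℕ) (_ : NeZero N) (K : Type) (_ : Field K) (_ : NumberField K)
      (Dt : ModularParametrizationData W N) (H : HeegnerDatum N (NumberField.discr K)) (ι : K →+* ℂ)
      (P : (W.baseChange K).toAffine.Point)
      (Wd : WeierstrassCurve ℚ) (_ : Wd.IsElliptic) (_ : Wd.IsGloballyMinimal) (Cd : VariableChange ℚ),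
      W.conductorNorm ℤ = N ∧ IsImaginaryQuadratic K ∧ SatisfiesHeegnerHypothesis N K ∧
      (W.quadraticTwist (NumberField.discr K : ℚ)).entireLFunction 1 ≠ 0 ∧
      WeierstrassCurve.Affine.Point.map ι.toRatAlgHom P = heegnerPointComplex Dt H ∧
      Cd • W.quadraticTwist (NumberField.discr K : ℚ) = Wd ∧
      (Finite (W.baseChange K).sha →
        (2 * padicValNat 3 (AddSubgroup.zmultiples P).index : ℤ) ≤
          padicValNat 3 (W.baseChange K).shaOrder + padicValNat 3 W.tamagawaProduct +
            padicValNat 3 Wd.tamagawaProduct + 2 * padicValRat 3 (Dt.c : ℚ)) := by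
  subst hWeq
  haveI := isElliptic_gWd439794p1; haveI := isGloballyMinimal_gWd439794p1
  haveI : Fact ((-95 : ℤ) < 0) := ⟨by norm_num⟩
  haveI : NeZero (439794 : ℕ) := ⟨by norm_num⟩
  have hlow : MissingLowerBoundAt (⟨1, -1, 0, -412053, -101704843⟩ : WeierstrassCurve ℚ) 3 :=
    RamifiedHeegnerPairL1Intrinsic.lowerHalf_three_439794p1 hGZK hr hq hv hSel
  have hjac : ∀ ℓ : ℕ, ℓ.Prime → ℓ ∣ 439794 → ℓ ≠ 2 → jacobiSym (-95) ℓ = 1 := by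
    intro ℓ hℓ hℓN hℓ2
    have hmem : ℓ ∈ Nat.primeFactors 439794 := Nat.mem_primeFactors.mpr ⟨hℓ, hℓN, by norm_num⟩
    have hpf : Nat.primeFactors 439794 = {2, 3, 53, 461} := by decide +kernel
    rw [hpf] at hmem
    simp only [Finset.mem_insert, Finset.mem_singleton] at hmem
    rcases hmem with rfl | rfl | rfl | rfl
    · exact absurd rfl hℓ2
    all_goals norm_num
  have hWd : (⟨1, ((-24 : ℚ)), ((1 : ℚ)/2), (0 : ℚ)⟩ : VariableChange ℚ) •
      (⟨1, -1, 0, -412053, -101704843⟩ : WeierstrassCurve ℚ).quadraticTwist ((-95 : ℤ) : ℚ) = (⟨1, -1, 0, -3718780017, 87288440474141⟩ : WeierstrassCurve ℚ) := by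
    push_cast
    ext <;> simp [WeierstrassCurve.variableChange_a₁, WeierstrassCurve.variableChange_a₂,
      WeierstrassCurve.variableChange_a₃, WeierstrassCurve.variableChange_a₄, WeierstrassCurve.variableChange_a₆,
      WeierstrassCurve.quadraticTwist, WeierstrassCurve.b₂, WeierstrassCurve.b₄, WeierstrassCurve.b₆] <;> norm_num
  exact existsAdjustedStepLAt_of_sqrtField _ 439794 (-95) (by norm_num)
    (by rw [show (-95 : ℤ).natAbs = 95 by rfl, Nat.squarefree_iff_nodup_primeFactorsList (by norm_num)]; simp)
    hjac 52319 (by norm_num) (by norm_num) hmodP hN hGZ hKo hGZK hmod hr hLt hlow _ _ hWd (by simp) hqd hvd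

/-! ## `205128l1` = `[0, 0, 0, -140542659, -679555229778]`, `N = 205128 = 2^3·3^2·7·11·37`, `K = ℚ(√-887)`, `Wd = [0, 0, 0, -110574607278771, 474237200867982859134]` (`N(Wd) = 161388351432`), kit j304074 -/

/-- **Row membership of `205128l1`, kernel part**: additive (G) ∧ ss at `3` and `ρ_{E,3}` onto (`n = 1` of the tower). The levels
`n ≥ 2`: `ρ_{E,9}` is onto — Frobenius witness `(a_ℓ, ℓ) mod 9 = (2, 5)` at `ℓ = 5`, outside the `(tr, det)`-profile of the 27 index-27 subgroups AND of the index-3 subgroup, these being ALL maximal mod-3-surjective proper subgroups of `GL₂(ℤ/9)`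
(exact enumeration, Lines card `stepl_intrinsic.md` of item 23191) — whence `ρ_{E,3^n}` onto for all `n` by Serre's lifting lemma; not typed here.
[cite: Serre1972, IV-23 Lemma 3 with its Exercise 3 (p = 3: surjectivity mod 9 suffices)] [cite: Cremona2006, Table 1 (Cremona label 205128l1)] -/
theorem row_205128l1 :
    haveI := isElliptic_g205128l1; haveI := isGloballyMinimal_g205128l1
    Addv (⟨0, 0, 0, -140542659, -679555229778⟩ : WeierstrassCurve ℚ) 3 ∧ SubGss (⟨0, 0, 0, -140542659, -679555229778⟩ : WeierstrassCurve ℚ) 3 ∧ (⟨0, 0, 0, -140542659, -679555229778⟩ : WeierstrassCurve ℚ).HasSurjectiveModNGaloisRep (3 ^ 1 : ℕ) := by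
  have h : (⟨0, 0, 0, -140542659, -679555229778⟩ : WeierstrassCurve ℚ).HasSurjectiveModNGaloisRep ((3 : ℕ) : ℤ) := surj_g205128l1_3
  exact ⟨subGss_g205128l1_3.1, subGss_g205128l1_3.2, by simpa using h⟩

/-- **STEP L (adjusted, tower-row shape) AT `205128l1` over `K = ℚ(√-887)`** — an instance of the `∃`-body of
`Sig.stub_existsAdjustedStepL_towerRows` (= `hEx` of §5) at an INTRINSIC class (`#Ш(E)_an = 9`). KERNEL: `K = sqrtField (-887)` (imaginary
quadratic, `d_K = -887`), the Heegner hypothesis at `N = 205128` (`-887 ≡ 1 (mod 8)`, `(-887/ℓ) = 1` at the odd `ℓ ∣ N`), the Heegner datum `β = 16355`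
(`4N ∣ β² − (-887)`), minimality of `Wd = [0, 0, 0, -110574607278771, 474237200867982859134]` (`k1 record, by name`), the twist identity `Cd • E^{(-887)} = Wd`,
`[u,r,s,t] = [1, 0, 0, 0]` (`3`-unit), `3 ∤ #𝓞_K^×`; `P ∈ E(K)` over the complex Heegner point is Darmon Thm 3.6 (tree theorem
`heegnerPointComplex_mem_range_map_holds`). PUBLISHED binders: `hmodP` (BCDT), `hGZ`, `hKo`, `hGZK`, `hmod`. DISPLAYED numerics: Cremona's
`N(E) = 205128` (`hN`), `r_an(E) = 1` (`hr`), `#Ш(E)_an = q`, `ord₃ q ≤ 2` (`hq`/`hv`), the rigorous 3-descent certificate `27 ∣ #Sel₃(E)` (`hSel`,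
L1Intrinsic records), `L(E^{(-887)},1) = 1.7926016266 ≠ 0` (`hLt`; PARI `ellL1` = `lfun`, agree True), `#Ш(Wd)_an = 100` (`hqd`/`hvd`;
`N(Wd) = 161388351432`, `∏c(Wd) = 32`, `#Wd(ℚ)_tors = 2`). INSTRUMENT (not used in the proof): Gross–Zagier heights give `[E(K):ℤy_K]² /4 = ρ = ĥ(y_K)/ĥ(P_gen) = 14400.0`, `m = 240` (`ord₃ m = 1`; float error 0.0e+00); BSD-budget prediction `ord₃ m = (ord₃#Ш(E)_an + ord₃#Ш(Wd)_an + ord₃∏c(E) + ord₃∏c(Wd))/2 = (2+0+0+0)/2 = 1`.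
Nothing is booked; L₁ / items 26021, 23191 stay OPEN; BSD is not proved by this.
[cite: JetchevSkinnerWan2017, §7.4.1 (pp. 29–31)] [cite: GrossZagier1986, Thm. I.(6.3), V.§2] [cite: Darmon2004, Thm. 3.6]
[cite: SchaeferStoll2004, Cor. 5.9] [cite: Marcus2018, Ch. 3 Thm. 25] [cite: Cremona2006, Table 1 (Cremona label 205128l1)] -/
theorem stepL_at_205128l1
    (hmodP : nonempty_modularParametrizationData)
    (hGZ : ∀ (N : ℕ) [NeZero N] (W : WeierstrassCurve ℚ) (K : Type) [Field K] [NumberField K], gross_zagier N W K)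
    (hKo : ∀ (N : ℕ) [NeZero N] (W : WeierstrassCurve ℚ) (K : Type) [Field K] [NumberField K], kolyvagin N W K)
    (hGZK : rank_eq_analyticRank_of_analyticRank_le_one) (hmod : hasEntireLFunction_rat)
    {W : WeierstrassCurve ℚ} [W.IsElliptic] [W.IsGloballyMinimal] (hWeq : W = (⟨0, 0, 0, -140542659, -679555229778⟩ : WeierstrassCurve ℚ))
    (hN : W.conductorNorm ℤ = 205128) (hr : W.analyticRank = 1)
    {q : ℚ} (hq : shaAn W = (q : ℂ)) (hv : padicValRat 3 q ≤ 2) (hSel : 3 ^ 3 ∣ Nat.card (W.selmerGroup 3))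
    (hLt : (W.quadraticTwist ((-887 : ℤ) : ℚ)).entireLFunction 1 ≠ 0)
    {qd : ℚ} (hqd : haveI := isElliptic_gWd205128l1; shaAn (⟨0, 0, 0, -110574607278771, 474237200867982859134⟩ : WeierstrassCurve ℚ) = (qd : ℂ)) (hvd : padicValRat 3 qd ≤ 0) :
    ∃ (N : ℕ) (_ : NeZero N) (K : Type) (_ : Field K) (_ : NumberField K)
      (Dt : ModularParametrizationData W N) (H : HeegnerDatum N (NumberField.discr K)) (ι : K →+* ℂ)
      (P : (W.baseChange K).toAffine.Point)
      (Wd : WeierstrassCurve ℚ) (_ : Wd.IsElliptic) (_ : Wd.IsGloballyMinimal) (Cd : VariableChange ℚ),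
      W.conductorNorm ℤ = N ∧ IsImaginaryQuadratic K ∧ SatisfiesHeegnerHypothesis N K ∧
      (W.quadraticTwist (NumberField.discr K : ℚ)).entireLFunction 1 ≠ 0 ∧
      WeierstrassCurve.Affine.Point.map ι.toRatAlgHom P = heegnerPointComplex Dt H ∧
      Cd • W.quadraticTwist (NumberField.discr K : ℚ) = Wd ∧
      (Finite (W.baseChange K).sha →
        (2 * padicValNat 3 (AddSubgroup.zmultiples P).index : ℤ) ≤
          padicValNat 3 (W.baseChange K).shaOrder + padicValNat 3 W.tamagawaProduct +
            padicValNat 3 Wd.tamagawaProduct + 2 * padicValRat 3 (Dt.c : ℚ)) := by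
  subst hWeq
  haveI := isElliptic_gWd205128l1; haveI := isGloballyMinimal_gWd205128l1
  haveI : Fact ((-887 : ℤ) < 0) := ⟨by norm_num⟩
  haveI : NeZero (205128 : ℕ) := ⟨by norm_num⟩
  have hlow : MissingLowerBoundAt (⟨0, 0, 0, -140542659, -679555229778⟩ : WeierstrassCurve ℚ) 3 :=
    RamifiedHeegnerPairL1Intrinsic.lowerHalf_three_205128l1 hGZK hr hq hv hSel
  have hjac : ∀ ℓ : ℕ, ℓ.Prime → ℓ ∣ 205128 → ℓ ≠ 2 → jacobiSym (-887) ℓ = 1 := by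
    intro ℓ hℓ hℓN hℓ2
    have hmem : ℓ ∈ Nat.primeFactors 205128 := Nat.mem_primeFactors.mpr ⟨hℓ, hℓN, by norm_num⟩
    have hpf : Nat.primeFactors 205128 = {2, 3, 7, 11, 37} := by decide +kernel
    rw [hpf] at hmem
    simp only [Finset.mem_insert, Finset.mem_singleton] at hmem
    rcases hmem with rfl | rfl | rfl | rfl | rfl
    · exact absurd rfl hℓ2
    all_goals norm_num
  have hWd : (⟨1, (0 : ℚ), (0 : ℚ), (0 : ℚ)⟩ : VariableChange ℚ) •
      (⟨0, 0, 0, -140542659, -679555229778⟩ : WeierstrassCurve ℚ).quadraticTwist ((-887 : ℤ) : ℚ) = (⟨0, 0, 0, -110574607278771, 474237200867982859134⟩ : WeierstrassCurve ℚ) := by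
    push_cast
    ext <;> simp [WeierstrassCurve.variableChange_a₁, WeierstrassCurve.variableChange_a₂,
      WeierstrassCurve.variableChange_a₃, WeierstrassCurve.variableChange_a₄, WeierstrassCurve.variableChange_a₆,
      WeierstrassCurve.quadraticTwist, WeierstrassCurve.b₂, WeierstrassCurve.b₄, WeierstrassCurve.b₆] <;> norm_num
  exact existsAdjustedStepLAt_of_sqrtField _ 205128 (-887) (by norm_num)
    (by rw [show (-887 : ℤ).natAbs = 887 by rfl, Nat.squarefree_iff_nodup_primeFactorsList (by norm_num)]; simp)
    hjac 16355 (by norm_num) (by norm_num) hmodP hN hGZ hKo hGZK hmod hr hLt hlow _ _ hWd (by simp) hqd hvd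

end Summit.BirchSwinnertonDyer.BirchSwinnertonDyer.Theorems.RamifiedHeegnerPairStepLIntrinsic

end
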